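import Summits.HubbardSuperconductivity.HubbardSuperconductivity.Theorems.AnisotropyChordTransferLadderIdentity

/-!
# Route `AnisotropyChord` / H0 rotor rung, route (1): LEMMA E, step 2 — spin-flip bookkeeping for the DOUBLE-COMMUTATOR BOUND
# `W⁺(b) + W⁻(b) ≤ (Σ_x Σ_y [x ∼ y])·Σ b²`, hence `LadderExcessBound` (LEMMA E) HOLDS
(prover seat `hubbard-h0-rotor-p1` g13; theory seat `hubbard-h0-rotor-theory-1` THEOREM-T.md «LEMMA E» (Koma–Tasaki double
commutator), memo ROTOR-THEORY-11 §175)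

With `W = Σ_bonds SᶻSᶻ` (`isingW`) and the local field `h_x = Σ_{y∼x} Sᶻ_y` (`hloc`): flipping `x` changes `W` by `±h_x`
(`isingW_sub_update_one`, `isingW_update_zero_sub`); by adjointness (`sum_mul_lowerSum_eq_sum_raiseSum_mul`)
`W⁺(b) = ⟨b, [S⁻,W] S⁺ b⟩`, `W⁻(b) = ⟨b, [S⁺,W] S⁻ b⟩` (`raiseCommW_eq`, `lowerCommW_eq`); expanding `S^±` gives a DIAGONAL part
`−4⟨b, W b⟩ ≤ ½(ΣΣ[∼])Σb²` and an OFF-DIAGONAL part which, symmetrised under `τ ↦ τ ∘ swap x x'`, localises on the bonds: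
`½ Σ_{x∼x'} Σ_{τ_x ≠ τ_{x'}} b(τ) b(τ∘swap) ≤ ½(ΣΣ[∼])Σb²` (`commW_le`).  On the torus `ΣΣ[∼] ≤ 4L²`, so for unit `b`:
`W⁺ + W⁻ ≤ 4L²` and **`ladderExcessBound_holds : LadderExcessBound`**.
-/

set_option linter.dupNamespace false
set_option autoImplicit false

noncomputable section

open Finset Filter Topology
open Literature.MathematicalPhysics.QuantumLattice Literature.Probability.LatticeModels
open Summit.HubbardSuperconductivity.HubbardSuperconductivity.Theorems.AnisotropyChord.InsertionEntropy
open Summit.HubbardSuperconductivity.HubbardSuperconductivity.Theorems.AnisotropyChord.Tower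
open Summit.HubbardSuperconductivity.HubbardSuperconductivity.Theorems.AnisotropyChord

namespace Summit.HubbardSuperconductivity.HubbardSuperconductivity.Theorems.AnisotropyChord.Transfer

section General

variable {V : Type} [Fintype V] [DecidableEq V] (G : SimpleGraph V) [DecidableRel G.Adj]

/-- `Sᶻ_y(σ) = 1/2 − σ_y`. [folklore] -/
def sz (σ : V → Fin 2) (y : V) : ℝ := (1/2 : ℝ) - ((σ y : ℕ) : ℝ)

/-- the local field `h_x(σ) = Σ_{y ∼ x} Sᶻ_y(σ)`. [folklore] -/
def hloc (σ : V → Fin 2) (x : V) : ℝ := ∑ y, if G.Adj x y then sz σ y else 0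

/-- the number of ordered adjacent pairs `Σ_x Σ_y [x ∼ y]` (`= 2|E|`). [folklore] -/
def adjCount : ℝ := ∑ x : V, ∑ y : V, if G.Adj x y then (1:ℝ) else 0

omit [DecidableEq V] in
/-- `isingW σ = ½ Σ_x Σ_y [x∼y] Sᶻ_x Sᶻ_y`. [folklore] -/
theorem isingW_eq_sz (σ : V → Fin 2) :
    isingW G σ = (1/2 : ℝ) * ∑ x, ∑ y, if G.Adj x y then sz σ x * sz σ y else 0 := by
  unfold isingW sz
  congr 1
  refine Finset.sum_congr rfl fun x _ => Finset.sum_congr rfl fun y _ => ?_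
  by_cases h : G.Adj x y
  · simp only [h, if_true]
    rcases Fin.exists_fin_two.mp ⟨σ x, rfl⟩ with hx | hx <;>
      rcases Fin.exists_fin_two.mp ⟨σ y, rfl⟩ with hy | hy <;> simp [hx, hy] <;> norm_num
  · simp [h]

omit [DecidableEq V] in
/-- `Σ_x h_x(σ)·Sᶻ_x(σ) = 2·isingW σ`. [folklore] -/
theorem sum_hloc_mul_sz (σ : V → Fin 2) : ∑ x, hloc G σ x * sz σ x = 2 * isingW G σ := by
  rw [isingW_eq_sz]
  have : ∀ x, hloc G σ x * sz σ x = ∑ y, if G.Adj x y then sz σ x * sz σ y else 0 := by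
    intro x; unfold hloc; rw [Finset.sum_mul]
    refine Finset.sum_congr rfl fun y _ => ?_
    split_ifs <;> ring
  simp_rw [this]; ring

/-- the local field does not see the spin at `x` itself. [folklore] -/
theorem hloc_update (σ : V → Fin 2) (x : V) (v : Fin 2) : hloc G (Function.update σ x v) x = hloc G σ x := by
  unfold hloc
  refine Finset.sum_congr rfl fun y _ => ?_
  by_cases h : G.Adj x y
  · have hne : y ≠ x := by rintro rfl; exact G.irrefl h
    simp [sz, Function.update_of_ne hne]
  · simp [h]

/-- flipping `x` from up (`0`) to down (`1`) lowers `W` by `h_x`: `W(σ) − W(σ_{x↦1}) = h_x(σ)` for `σ x = 0`. [folklore] -/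
theorem isingW_sub_update_one (σ : V → Fin 2) (x : V) (hx : σ x = 0) :
    isingW G σ - isingW G (Function.update σ x 1) = hloc G σ x := by
  rw [isingW_eq_sz, isingW_eq_sz, ← mul_sub, ← Finset.sum_sub_distrib]
  set σ' := Function.update σ x 1 with hσ'
  -- Sᶻ changes only at x: sz σ' u = sz σ u − [u = x]
  have hsz : ∀ u, sz σ' u = sz σ u - (if u = x then (1:ℝ) else 0) := by
    intro u
    by_cases hu : u = x
    · subst hu; simp [sz, hσ', hx]
    · simp [sz, hσ', hu]
  have hterm : ∀ u v, (if G.Adj u v then sz σ u * sz σ v else 0) - (if G.Adj u v then sz σ' u * sz σ' v else 0)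
      = (if G.Adj u v then (if u = x then (1:ℝ) else 0) * sz σ v else 0)
        + (if G.Adj u v then (if v = x then (1:ℝ) else 0) * sz σ u else 0) := by
    intro u v
    by_cases h : G.Adj u v
    · have huv : ¬ (u = x ∧ v = x) := by
        rintro ⟨e1, e2⟩; rw [e1, e2] at h; exact G.irrefl h
      rw [if_pos h, if_pos h, if_pos h, if_pos h, hsz u, hsz v]
      by_cases hu : u = x
      · have hv : ¬ v = x := fun hv => huv ⟨hu, hv⟩
        rw [if_pos hu, if_neg hv]; ring
      · by_cases hv : v = x
        · rw [if_neg hu, if_pos hv]; ring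
        · rw [if_neg hu, if_neg hv]; ring
    · simp [h]
  simp_rw [← Finset.sum_sub_distrib, hterm, Finset.sum_add_distrib]
  have h1 : ∑ u, ∑ v, (if G.Adj u v then (if u = x then (1:ℝ) else 0) * sz σ v else 0) = hloc G σ x := by
    rw [Finset.sum_eq_single x]
    · unfold hloc; refine Finset.sum_congr rfl fun v _ => ?_; simp
    · intro u _ hu; apply Finset.sum_eq_zero; intro v _; simp [hu]
    · intro h; exact absurd (Finset.mem_univ x) h
  have h2 : ∑ u, ∑ v, (if G.Adj u v then (if v = x then (1:ℝ) else 0) * sz σ u else 0) = hloc G σ x := by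
    rw [Finset.sum_comm, Finset.sum_eq_single x]
    · unfold hloc; refine Finset.sum_congr rfl fun u _ => ?_
      have : G.Adj u x ↔ G.Adj x u := G.adj_comm u x
      by_cases h : G.Adj x u
      · simp [h, this.mpr h]
      · have h' : ¬ G.Adj u x := fun e => h (this.mp e)
        simp [h, h']
    · intro v _ hv; apply Finset.sum_eq_zero; intro u _; simp [hv]
    · intro h; exact absurd (Finset.mem_univ x) h
  rw [h1, h2]; ring

/-- flipping `x` from down (`1`) to up (`0`) raises `W` by `h_x`: `W(τ_{x↦0}) − W(τ) = h_x(τ)` for `τ x = 1`. [folklore] -/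
theorem isingW_update_zero_sub (τ : V → Fin 2) (x : V) (hx : τ x = 1) :
    isingW G (Function.update τ x 0) - isingW G τ = hloc G τ x := by
  have h := isingW_sub_update_one G (Function.update τ x 0) x (by simp)
  rw [Function.update_idem, hloc_update] at h
  have e : Function.update τ x (1 : Fin 2) = τ := by rw [← hx, Function.update_eq_self]
  rw [e] at h
  exact h

omit [Fintype V] in
/-- the swapped configuration as a double update. [folklore] -/
theorem update_update_eq_comp_swap (τ : V → Fin 2) {x x' : V} (hxx : x ≠ x') :
    Function.update (Function.update τ x (τ x')) x' (τ x) = τ ∘ ⇑(Equiv.swap x x') := by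
  funext z
  by_cases hz' : z = x'
  · subst hz'; simp [Equiv.swap_apply_right]
  · by_cases hz : z = x
    · subst hz; simp [Function.update_of_ne hz', Equiv.swap_apply_left]
    · simp [Function.update_of_ne hz', Function.update_of_ne hz, Equiv.swap_apply_of_ne_of_ne hz hz']

/-- `([S⁻, W] S⁺ b)(τ) = Σ_x [τ x = 1] h_x(τ) (S⁺b)(τ_{x↦0})`. [folklore] -/
theorem lowerComm_raise_point (b : (V → Fin 2) → ℝ) (τ : V → Fin 2) :
    lowerSum (wMul G (raiseSum b)) τ - isingW G τ * lowerSum (raiseSum b) τ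
      = ∑ x, if τ x = 1 then hloc G τ x * raiseSum b (Function.update τ x 0) else 0 := by
  unfold lowerSum wMul
  rw [Finset.mul_sum, ← Finset.sum_sub_distrib]
  refine Finset.sum_congr rfl fun x _ => ?_
  by_cases hx : τ x = 1
  · simp only [hx, if_true]
    have := isingW_update_zero_sub G τ x hx
    calc isingW G (Function.update τ x 0) * raiseSum b (Function.update τ x 0)
          - isingW G τ * raiseSum b (Function.update τ x 0)
        = (isingW G (Function.update τ x 0) - isingW G τ) * raiseSum b (Function.update τ x 0) := by ring
      _ = hloc G τ x * raiseSum b (Function.update τ x 0) := by rw [this]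
  · simp [hx]

/-- `([S⁺, W] S⁻ b)(σ) = −Σ_x [σ x = 0] h_x(σ) (S⁻b)(σ_{x↦1})`. [folklore] -/
theorem raiseComm_lower_point (b : (V → Fin 2) → ℝ) (σ : V → Fin 2) :
    raiseSum (wMul G (lowerSum b)) σ - isingW G σ * raiseSum (lowerSum b) σ
      = ∑ x, if σ x = 0 then -(hloc G σ x * lowerSum b (Function.update σ x 1)) else 0 := by
  unfold raiseSum wMul
  rw [Finset.mul_sum, ← Finset.sum_sub_distrib]
  refine Finset.sum_congr rfl fun x _ => ?_
  by_cases hx : σ x = 0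
  · simp only [hx, if_true]
    have := isingW_sub_update_one G σ x hx
    calc isingW G (Function.update σ x 1) * lowerSum b (Function.update σ x 1)
          - isingW G σ * lowerSum b (Function.update σ x 1)
        = -((isingW G σ - isingW G (Function.update σ x 1)) * lowerSum b (Function.update σ x 1)) := by ring
      _ = -(hloc G σ x * lowerSum b (Function.update σ x 1)) := by rw [this]
  · simp [hx]

/-- `(S⁺b)(τ_{x↦0}) = b τ + Σ_{x' ≠ x, τ x' = 0} b(τ ∘ swap x x')` for `τ x = 1`. [folklore] -/
theorem raiseSum_update_zero (b : (V → Fin 2) → ℝ) (τ : V → Fin 2) (x : V) (hx : τ x = 1) :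
    raiseSum b (Function.update τ x 0)
      = b τ + ∑ x', if x' ≠ x ∧ τ x' = 0 then b (τ ∘ ⇑(Equiv.swap x x')) else 0 := by
  unfold raiseSum
  rw [← Finset.add_sum_erase _ _ (Finset.mem_univ x)]
  congr 1
  · simp only [Function.update_self, if_true, Function.update_idem]
    rw [← hx, Function.update_eq_self]
  · rw [← Finset.sum_erase (s := univ) (a := x)
        (f := fun x' => if x' ≠ x ∧ τ x' = 0 then b (τ ∘ ⇑(Equiv.swap x x')) else 0) (by simp)]
    refine Finset.sum_congr rfl fun x' hx' => ?_
    have hne : x' ≠ x := Finset.ne_of_mem_erase hx'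
    rw [Function.update_of_ne hne]
    by_cases h0 : τ x' = 0
    · simp only [h0, if_true, hne, ne_eq, not_false_eq_true, true_and]
      have := update_update_eq_comp_swap τ (Ne.symm hne)
      rw [h0, hx] at this; rw [this]
    · simp [h0, hne]

/-- `(S⁻b)(σ_{x↦1}) = b σ + Σ_{x' ≠ x, σ x' = 1} b(σ ∘ swap x x')` for `σ x = 0`. [folklore] -/
theorem lowerSum_update_one (b : (V → Fin 2) → ℝ) (σ : V → Fin 2) (x : V) (hx : σ x = 0) :
    lowerSum b (Function.update σ x 1)
      = b σ + ∑ x', if x' ≠ x ∧ σ x' = 1 then b (σ ∘ ⇑(Equiv.swap x x')) else 0 := by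
  unfold lowerSum
  rw [← Finset.add_sum_erase _ _ (Finset.mem_univ x)]
  congr 1
  · simp only [Function.update_self, if_true, Function.update_idem]
    rw [← hx, Function.update_eq_self]
  · rw [← Finset.sum_erase (s := univ) (a := x)
        (f := fun x' => if x' ≠ x ∧ σ x' = 1 then b (σ ∘ ⇑(Equiv.swap x x')) else 0) (by simp)]
    refine Finset.sum_congr rfl fun x' hx' => ?_
    have hne : x' ≠ x := Finset.ne_of_mem_erase hx'
    rw [Function.update_of_ne hne]
    by_cases h1 : σ x' = 1
    · simp only [h1, if_true, hne, ne_eq, not_false_eq_true, true_and]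
      have := update_update_eq_comp_swap σ (Ne.symm hne)
      rw [h1, hx] at this; rw [this]
    · simp [h1, hne]

/-- **`W⁺(b) = ⟨b, [S⁻, W] S⁺ b⟩` expanded:** diagonal + off-diagonal parts. [folklore] -/
theorem raiseCommW_eq (b : (V → Fin 2) → ℝ) :
    raiseCommW G b = ∑ τ, b τ ^ 2 * ∑ x, (if τ x = 1 then hloc G τ x else 0)
      + ∑ τ, ∑ x, ∑ x', if x' ≠ x ∧ τ x = 1 ∧ τ x' = 0
          then hloc G τ x * (b τ * b (τ ∘ ⇑(Equiv.swap x x'))) else 0 := by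
  unfold raiseCommW
  have h1 : ∑ σ, isingW G σ * raiseSum b σ ^ 2 = ∑ τ, b τ * lowerSum (wMul G (raiseSum b)) τ := by
    rw [sum_mul_lowerSum_eq_sum_raiseSum_mul]
    refine Finset.sum_congr rfl fun σ _ => ?_; unfold wMul; ring
  have h2 : ∑ σ, raiseSum b σ * raiseSum (wMul G b) σ = ∑ τ, b τ * (isingW G τ * lowerSum (raiseSum b) τ) := by
    have := sum_mul_lowerSum_eq_sum_raiseSum_mul (raiseSum b) (wMul G b)
    rw [show ∑ σ, raiseSum b σ * raiseSum (wMul G b) σ = ∑ σ, raiseSum (wMul G b) σ * raiseSum b σ from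
      Finset.sum_congr rfl fun σ _ => mul_comm _ _, ← this]
    refine Finset.sum_congr rfl fun τ _ => ?_; unfold wMul; ring
  rw [h1, h2, ← Finset.sum_sub_distrib, ← Finset.sum_add_distrib]
  refine Finset.sum_congr rfl fun τ _ => ?_
  rw [← mul_sub, lowerComm_raise_point, Finset.mul_sum, Finset.mul_sum, ← Finset.sum_add_distrib]
  refine Finset.sum_congr rfl fun x _ => ?_
  by_cases hx : τ x = 1
  · rw [if_pos hx, if_pos hx, raiseSum_update_zero b τ x hx]
    have hS : ∑ x', (if x' ≠ x ∧ τ x = 1 ∧ τ x' = 0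
        then hloc G τ x * (b τ * b (τ ∘ ⇑(Equiv.swap x x'))) else 0)
        = (hloc G τ x * b τ) * ∑ x', (if x' ≠ x ∧ τ x' = 0 then b (τ ∘ ⇑(Equiv.swap x x')) else 0) := by
      rw [Finset.mul_sum]
      refine Finset.sum_congr rfl fun x' _ => ?_
      by_cases h' : x' ≠ x ∧ τ x' = 0
      · rw [if_pos h', if_pos ⟨h'.1, hx, h'.2⟩]; ring
      · rw [if_neg h', if_neg (fun h => h' ⟨h.1, h.2.2⟩)]; ring
    rw [hS]; ring
  · rw [if_neg hx, if_neg hx, mul_zero, mul_zero, zero_add]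
    symm; apply Finset.sum_eq_zero; intro x' _
    rw [if_neg (fun h => hx h.2.1)]

/-- **`W⁻(b) = ⟨b, [S⁺, W] S⁻ b⟩` expanded.** [folklore] -/
theorem lowerCommW_eq (b : (V → Fin 2) → ℝ) :
    lowerCommW G b = ∑ σ, (-(b σ ^ 2 * ∑ x, (if σ x = 0 then hloc G σ x else 0)))
      + ∑ σ, ∑ x, ∑ x', if x' ≠ x ∧ σ x = 0 ∧ σ x' = 1
          then -(hloc G σ x * (b σ * b (σ ∘ ⇑(Equiv.swap x x')))) else 0 := by
  unfold lowerCommW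
  have h1 : ∑ τ, isingW G τ * lowerSum b τ ^ 2 = ∑ σ, b σ * raiseSum (wMul G (lowerSum b)) σ := by
    rw [show ∑ σ, b σ * raiseSum (wMul G (lowerSum b)) σ = ∑ σ, raiseSum (wMul G (lowerSum b)) σ * b σ from
      Finset.sum_congr rfl fun σ _ => mul_comm _ _, ← sum_mul_lowerSum_eq_sum_raiseSum_mul]
    refine Finset.sum_congr rfl fun τ _ => ?_; unfold wMul; ring
  have h2 : ∑ τ, lowerSum b τ * lowerSum (wMul G b) τ = ∑ σ, b σ * (isingW G σ * raiseSum (lowerSum b) σ) := by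
    rw [sum_mul_lowerSum_eq_sum_raiseSum_mul (wMul G b) (lowerSum b)]
    refine Finset.sum_congr rfl fun σ _ => ?_; unfold wMul; ring
  rw [h1, h2, ← Finset.sum_sub_distrib, ← Finset.sum_add_distrib]
  refine Finset.sum_congr rfl fun σ _ => ?_
  rw [← mul_sub, raiseComm_lower_point, Finset.mul_sum, Finset.mul_sum, ← Finset.sum_neg_distrib,
    ← Finset.sum_add_distrib]
  refine Finset.sum_congr rfl fun x _ => ?_
  by_cases hx : σ x = 0
  · rw [if_pos hx, if_pos hx, lowerSum_update_one b σ x hx]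
    have hS : ∑ x', (if x' ≠ x ∧ σ x = 0 ∧ σ x' = 1
        then -(hloc G σ x * (b σ * b (σ ∘ ⇑(Equiv.swap x x')))) else 0)
        = -(hloc G σ x * b σ) * ∑ x', (if x' ≠ x ∧ σ x' = 1 then b (σ ∘ ⇑(Equiv.swap x x')) else 0) := by
      rw [Finset.mul_sum]
      refine Finset.sum_congr rfl fun x' _ => ?_
      by_cases h' : x' ≠ x ∧ σ x' = 1
      · rw [if_pos h', if_pos ⟨h'.1, hx, h'.2⟩]; ring
      · rw [if_neg h', if_neg (fun h => h' ⟨h.1, h.2.2⟩)]; ring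
    rw [hS]; ring
  · rw [if_neg hx, if_neg hx, mul_zero, mul_zero, neg_zero, zero_add]
    symm; apply Finset.sum_eq_zero; intro x' _
    rw [if_neg (fun h => hx h.2.1)]

end General

end Summit.HubbardSuperconductivity.HubbardSuperconductivity.Theorems.AnisotropyChord.Transfer
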